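import Summits.BirchSwinnertonDyer.BirchSwinnertonDyer.Theorems.BiquadraticEisensteinDescentManinDatumSupercuspidalCMInertSevenDivisionPoints
import Summits.BirchSwinnertonDyer.BirchSwinnertonDyer.Theorems.BiquadraticEisensteinDescentManinDatumSupercuspidalCMInertFormalParameterAddition
import HarnessLib

set_option linter.dupNamespace false -- `Summit.BirchSwinnertonDyer.BirchSwinnertonDyer.Theorems.…` (summit = sub, D-0017)
set_option autoImplicit false

/-!
# Crux `ManinDatumSupercuspidalCMInert` (stmt-BirchSwinnertonDyer-20111, BED r605), CM side of H₇ — step (d) of memo PLAIN-ODD-57,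
# second brick (b): THE TAME CHARACTER IS THE CM CHARACTER — `t(P_u) ≡ u · t(P_1) (mod 𝔪·t)` for `t = x/y` on the `7`-division
# points `P_c = (X(c/7), Y(c/7))` of `y² = x³ − x` and every `u ∈ ℤ[i] ∖ 7ℤ[i]`

Route `BiquadraticEisensteinDescent` (cell `pub/bsd-wall`, width seat `bsd-wall-cm-bed-w4` g11, RESOLVENT LANE; `--supports`
stmt-BirchSwinnertonDyer-20111, helper). THEOREMS ONLY (no definition, no named fact, no `sorry`); nothing is closed by this file and BSD is
not proved by any of it.

With `X_c = ℘(c/7)/ϖ₀²`, `Y_c = ℘′(c/7)/(2ϖ₀³)`, `t_c = X_c/Y_c` (`…SevenDivisionPoints`) and any valuation `v` of `ℂ` with `v 7 < 1`: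
* §3 `chord_collinear` — for generic `(c, d)` the points `P_c`, `P_d`, `−P_{c+d}` lie on one line `y = Lx + M` (tree addition theorems
  `weierstrassP_add_holds` / `normalizedX_add`, `derivWeierstrassP_add_of_ne`, i.e. `PeriodPair.toPoint_add`);
* §4 ★ `val_t_add_sub_le` — `v(t_{c+d} − t_c − t_d) ≤ v(t_1)⁵` for generic `(c, d)` (`c, d, c ± d, 2c + d, c + 2d ∉ 7ℤ[i]`): brick 1
  (`…FormalParameterAddition.val_formalParameter_add_le`) on the chord `P_c, P_d, −P_{c+d}` (`…SevenDivisionPoints.chord_collinear`);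
* §5 ★★ `val_t_sub_mul_lt` — **`v(t_u − u·t_1) < v(t_1)` for every `u ∈ ℤ[i] ∖ 7ℤ[i]`** (induction `…SevenDivisionPoints.induction_mod_seven`
  over generic sums, `[i]` and `[−1]` exactly, `7t_1 ∈ 𝔪·t_1`): the tame character `σ_u ↦ t(σ_uQ₁)/t(Q₁) mod 𝔪` of the totally ramified
  layer `ℚ(i)(E₀[7])/ℚ(i)` at `7` is `u mod 7` — the exponent «`a ≡ 1 (mod 4)`, pinned by `[i]`» of memo PLAIN-ODD-57 §3(d), i.e. the
  hypothesis `hχθ`/`hθ` input of `…TameResolvent.resolvent_valuation_le` in the design note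
  `Cruxes/ManinDatumSupercuspidalCMInert/MODEL-ASSEMBLY-LANES-w2g10.md` (X-FORMAL route, consequence (3)).

References: [SilvermanAEC2009] IV.1 (formal group law), VII.3; [Serre1979] Ch. IV §2 Prop. 7 (tame character); [SilvermanATAEC1994] II.1–II.2.
-/

noncomputable section

open Complex PeriodPair
open scoped PeriodPair
open Literature.NumberTheory.EllipticCurves Literature.NumberTheory.EllipticCurves.GaussianLattice

namespace Summit.BirchSwinnertonDyer.BirchSwinnertonDyer.Theorems.BiquadraticEisensteinDescentManinDatumSupercuspidalCMInertSevenDivisionTameCharacter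

open Summit.BirchSwinnertonDyer.BirchSwinnertonDyer.Theorems.BiquadraticEisensteinDescentManinDatumSupercuspidalCMInertSevenDivisionEisenstein
  (val_intCast_le_one)
open Summit.BirchSwinnertonDyer.BirchSwinnertonDyer.Theorems.BiquadraticEisensteinDescentManinDatumSupercuspidalCMInertFormalParameterAddition
  (val_formalParameter_add_le)
open Summit.BirchSwinnertonDyer.BirchSwinnertonDyer.Theorems.BiquadraticEisensteinDescentManinDatumSupercuspidalCMInertSevenDivisionPoints
open Summit.BirchSwinnertonDyer.BirchSwinnertonDyer.Theorems.BiquadraticEisensteinDescentManinDatumSupercuspidalCMInertFormalChord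
  (normalizedX_add)

/-! ## §3 The chord through `P_c`, `P_d` and `−P_{c+d}` -/

section Chord

/-- **Addition theorem for `℘′` in normalised coordinates**: for `u, t ∉ Λ` with `℘(u) ≠ ℘(t)` and `λ = (Y_u − Y_t)/(X_u − X_t)`,
`Y(u+t) = −(Y_u + λ·(X(u+t) − X_u))` (tree `derivWeierstrassP_add_of_ne`). [cite: SilvermanAEC2009, III.2.3(c)] -/
theorem normalizedY_add {u t : ℂ} (hu : u ∉ (ofUpperHalfPlane UpperHalfPlane.I).lattice) (ht : t ∉ (ofUpperHalfPlane UpperHalfPlane.I).lattice)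
    (hne : ℘[ofUpperHalfPlane UpperHalfPlane.I] u ≠ ℘[ofUpperHalfPlane UpperHalfPlane.I] t) :
    ℘'[ofUpperHalfPlane UpperHalfPlane.I] (u + t) / (2 * ((Real.Gamma (1 / 4) ^ 2 / (2 * Real.sqrt (2 * Real.pi)) : ℝ) : ℂ) ^ 3) =
      -(℘'[ofUpperHalfPlane UpperHalfPlane.I] u / (2 * ((Real.Gamma (1 / 4) ^ 2 / (2 * Real.sqrt (2 * Real.pi)) : ℝ) : ℂ) ^ 3) +
        (℘'[ofUpperHalfPlane UpperHalfPlane.I] u / (2 * ((Real.Gamma (1 / 4) ^ 2 / (2 * Real.sqrt (2 * Real.pi)) : ℝ) : ℂ) ^ 3) - ℘'[ofUpperHalfPlane UpperHalfPlane.I] t /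
            (2 * ((Real.Gamma (1 / 4) ^ 2 / (2 * Real.sqrt (2 * Real.pi)) : ℝ) : ℂ) ^ 3)) /
            (℘[ofUpperHalfPlane UpperHalfPlane.I] u / ((Real.Gamma (1 / 4) ^ 2 / (2 * Real.sqrt (2 * Real.pi)) : ℝ) : ℂ) ^ 2 - ℘[ofUpperHalfPlane UpperHalfPlane.I] t /
                ((Real.Gamma (1 / 4) ^ 2 / (2 * Real.sqrt (2 * Real.pi)) : ℝ) : ℂ) ^ 2) *
          (℘[ofUpperHalfPlane UpperHalfPlane.I] (u + t) / ((Real.Gamma (1 / 4) ^ 2 / (2 * Real.sqrt (2 * Real.pi)) : ℝ) : ℂ) ^ 2 - ℘[ofUpperHalfPlane UpperHalfPlane.I] u /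
              ((Real.Gamma (1 / 4) ^ 2 / (2 * Real.sqrt (2 * Real.pi)) : ℝ) : ℂ) ^ 2)) := by
  have hϖ0 := varpi_ne_zero'
  have hadd := derivWeierstrassP_add_of_ne (L := ofUpperHalfPlane UpperHalfPlane.I) hu ht hne
  have hsub : ℘[ofUpperHalfPlane UpperHalfPlane.I] u - ℘[ofUpperHalfPlane UpperHalfPlane.I] t ≠ 0 := sub_ne_zero.mpr hne
  rw [hadd]
  field_simp

/-- **The chord.** For `c, d ∈ ℤ[i]` with `c, d, c ± d ∉ 7ℤ[i]`, the slope `L = (Y_c − Y_d)/(X_c − X_d)` and `M = Y_c − L·X_c` satisfy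
`Y_c = L X_c + M`, `Y_d = L X_d + M` and `−Y_{c+d} = L X_{c+d} + M`: the points `P_c`, `P_d`, `−P_{c+d}` are collinear
(the addition theorems for `℘`, `℘′`, i.e. `toPoint (u + t) = toPoint u + toPoint t`). [cite: SilvermanAEC2009, III.2.3] -/
theorem chord_collinear {c d : GaussianInt} (hc : ¬ (7 : GaussianInt) ∣ c) (hd : ¬ (7 : GaussianInt) ∣ d)
    (hs : ¬ (7 : GaussianInt) ∣ c + d) (hm : ¬ (7 : GaussianInt) ∣ c - d) :
    (℘'[ofUpperHalfPlane UpperHalfPlane.I] (((c : GaussianInt) : ℂ) / 7) / (2 * ((Real.Gamma (1 / 4) ^ 2 / (2 * Real.sqrt (2 * Real.pi)) : ℝ) : ℂ) ^ 3)) =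
        ((℘'[ofUpperHalfPlane UpperHalfPlane.I] (((c : GaussianInt) : ℂ) / 7) / (2 * ((Real.Gamma (1 / 4) ^ 2 / (2 * Real.sqrt (2 * Real.pi)) : ℝ) : ℂ) ^ 3)) -
        (℘'[ofUpperHalfPlane UpperHalfPlane.I] (((d : GaussianInt) : ℂ) / 7) / (2 * ((Real.Gamma (1 / 4) ^ 2 / (2 * Real.sqrt (2 * Real.pi)) : ℝ) : ℂ) ^ 3))) /
        ((℘[ofUpperHalfPlane UpperHalfPlane.I] (((c : GaussianInt) : ℂ) / 7) / ((Real.Gamma (1 / 4) ^ 2 / (2 * Real.sqrt (2 * Real.pi)) : ℝ) : ℂ) ^ 2) -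
        (℘[ofUpperHalfPlane UpperHalfPlane.I] (((d : GaussianInt) : ℂ) / 7) / ((Real.Gamma (1 / 4) ^ 2 / (2 * Real.sqrt (2 * Real.pi)) : ℝ) : ℂ) ^ 2)) *
        (℘[ofUpperHalfPlane UpperHalfPlane.I] (((c : GaussianInt) : ℂ) / 7) / ((Real.Gamma (1 / 4) ^ 2 / (2 * Real.sqrt (2 * Real.pi)) : ℝ) : ℂ) ^ 2) +
        ((℘'[ofUpperHalfPlane UpperHalfPlane.I] (((c : GaussianInt) : ℂ) / 7) / (2 * ((Real.Gamma (1 / 4) ^ 2 / (2 * Real.sqrt (2 * Real.pi)) : ℝ) : ℂ) ^ 3)) -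
        ((℘'[ofUpperHalfPlane UpperHalfPlane.I] (((c : GaussianInt) : ℂ) / 7) / (2 * ((Real.Gamma (1 / 4) ^ 2 / (2 * Real.sqrt (2 * Real.pi)) : ℝ) : ℂ) ^ 3)) -
        (℘'[ofUpperHalfPlane UpperHalfPlane.I] (((d : GaussianInt) : ℂ) / 7) / (2 * ((Real.Gamma (1 / 4) ^ 2 / (2 * Real.sqrt (2 * Real.pi)) : ℝ) : ℂ) ^ 3))) /
        ((℘[ofUpperHalfPlane UpperHalfPlane.I] (((c : GaussianInt) : ℂ) / 7) / ((Real.Gamma (1 / 4) ^ 2 / (2 * Real.sqrt (2 * Real.pi)) : ℝ) : ℂ) ^ 2) -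
        (℘[ofUpperHalfPlane UpperHalfPlane.I] (((d : GaussianInt) : ℂ) / 7) / ((Real.Gamma (1 / 4) ^ 2 / (2 * Real.sqrt (2 * Real.pi)) : ℝ) : ℂ) ^ 2)) *
        (℘[ofUpperHalfPlane UpperHalfPlane.I] (((c : GaussianInt) : ℂ) / 7) / ((Real.Gamma (1 / 4) ^ 2 / (2 * Real.sqrt (2 * Real.pi)) : ℝ) : ℂ) ^ 2)) ∧
    (℘'[ofUpperHalfPlane UpperHalfPlane.I] (((d : GaussianInt) : ℂ) / 7) / (2 * ((Real.Gamma (1 / 4) ^ 2 / (2 * Real.sqrt (2 * Real.pi)) : ℝ) : ℂ) ^ 3)) =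
        ((℘'[ofUpperHalfPlane UpperHalfPlane.I] (((c : GaussianInt) : ℂ) / 7) / (2 * ((Real.Gamma (1 / 4) ^ 2 / (2 * Real.sqrt (2 * Real.pi)) : ℝ) : ℂ) ^ 3)) -
        (℘'[ofUpperHalfPlane UpperHalfPlane.I] (((d : GaussianInt) : ℂ) / 7) / (2 * ((Real.Gamma (1 / 4) ^ 2 / (2 * Real.sqrt (2 * Real.pi)) : ℝ) : ℂ) ^ 3))) /
        ((℘[ofUpperHalfPlane UpperHalfPlane.I] (((c : GaussianInt) : ℂ) / 7) / ((Real.Gamma (1 / 4) ^ 2 / (2 * Real.sqrt (2 * Real.pi)) : ℝ) : ℂ) ^ 2) -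
        (℘[ofUpperHalfPlane UpperHalfPlane.I] (((d : GaussianInt) : ℂ) / 7) / ((Real.Gamma (1 / 4) ^ 2 / (2 * Real.sqrt (2 * Real.pi)) : ℝ) : ℂ) ^ 2)) *
        (℘[ofUpperHalfPlane UpperHalfPlane.I] (((d : GaussianInt) : ℂ) / 7) / ((Real.Gamma (1 / 4) ^ 2 / (2 * Real.sqrt (2 * Real.pi)) : ℝ) : ℂ) ^ 2) +
        ((℘'[ofUpperHalfPlane UpperHalfPlane.I] (((c : GaussianInt) : ℂ) / 7) / (2 * ((Real.Gamma (1 / 4) ^ 2 / (2 * Real.sqrt (2 * Real.pi)) : ℝ) : ℂ) ^ 3)) -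
        ((℘'[ofUpperHalfPlane UpperHalfPlane.I] (((c : GaussianInt) : ℂ) / 7) / (2 * ((Real.Gamma (1 / 4) ^ 2 / (2 * Real.sqrt (2 * Real.pi)) : ℝ) : ℂ) ^ 3)) -
        (℘'[ofUpperHalfPlane UpperHalfPlane.I] (((d : GaussianInt) : ℂ) / 7) / (2 * ((Real.Gamma (1 / 4) ^ 2 / (2 * Real.sqrt (2 * Real.pi)) : ℝ) : ℂ) ^ 3))) /
        ((℘[ofUpperHalfPlane UpperHalfPlane.I] (((c : GaussianInt) : ℂ) / 7) / ((Real.Gamma (1 / 4) ^ 2 / (2 * Real.sqrt (2 * Real.pi)) : ℝ) : ℂ) ^ 2) -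
        (℘[ofUpperHalfPlane UpperHalfPlane.I] (((d : GaussianInt) : ℂ) / 7) / ((Real.Gamma (1 / 4) ^ 2 / (2 * Real.sqrt (2 * Real.pi)) : ℝ) : ℂ) ^ 2)) *
        (℘[ofUpperHalfPlane UpperHalfPlane.I] (((c : GaussianInt) : ℂ) / 7) / ((Real.Gamma (1 / 4) ^ 2 / (2 * Real.sqrt (2 * Real.pi)) : ℝ) : ℂ) ^ 2)) ∧
    -((℘'[ofUpperHalfPlane UpperHalfPlane.I] ((((c + d) : GaussianInt) : ℂ) / 7) / (2 * ((Real.Gamma (1 / 4) ^ 2 / (2 * Real.sqrt (2 * Real.pi)) : ℝ) : ℂ) ^ 3))) =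
        ((℘'[ofUpperHalfPlane UpperHalfPlane.I] (((c : GaussianInt) : ℂ) / 7) / (2 * ((Real.Gamma (1 / 4) ^ 2 / (2 * Real.sqrt (2 * Real.pi)) : ℝ) : ℂ) ^ 3)) -
        (℘'[ofUpperHalfPlane UpperHalfPlane.I] (((d : GaussianInt) : ℂ) / 7) / (2 * ((Real.Gamma (1 / 4) ^ 2 / (2 * Real.sqrt (2 * Real.pi)) : ℝ) : ℂ) ^ 3))) /
        ((℘[ofUpperHalfPlane UpperHalfPlane.I] (((c : GaussianInt) : ℂ) / 7) / ((Real.Gamma (1 / 4) ^ 2 / (2 * Real.sqrt (2 * Real.pi)) : ℝ) : ℂ) ^ 2) -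
        (℘[ofUpperHalfPlane UpperHalfPlane.I] (((d : GaussianInt) : ℂ) / 7) / ((Real.Gamma (1 / 4) ^ 2 / (2 * Real.sqrt (2 * Real.pi)) : ℝ) : ℂ) ^ 2)) *
        (℘[ofUpperHalfPlane UpperHalfPlane.I] ((((c + d) : GaussianInt) : ℂ) / 7) / ((Real.Gamma (1 / 4) ^ 2 / (2 * Real.sqrt (2 * Real.pi)) : ℝ) : ℂ) ^ 2) +
        ((℘'[ofUpperHalfPlane UpperHalfPlane.I] (((c : GaussianInt) : ℂ) / 7) / (2 * ((Real.Gamma (1 / 4) ^ 2 / (2 * Real.sqrt (2 * Real.pi)) : ℝ) : ℂ) ^ 3)) -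
        ((℘'[ofUpperHalfPlane UpperHalfPlane.I] (((c : GaussianInt) : ℂ) / 7) / (2 * ((Real.Gamma (1 / 4) ^ 2 / (2 * Real.sqrt (2 * Real.pi)) : ℝ) : ℂ) ^ 3)) -
        (℘'[ofUpperHalfPlane UpperHalfPlane.I] (((d : GaussianInt) : ℂ) / 7) / (2 * ((Real.Gamma (1 / 4) ^ 2 / (2 * Real.sqrt (2 * Real.pi)) : ℝ) : ℂ) ^ 3))) /
        ((℘[ofUpperHalfPlane UpperHalfPlane.I] (((c : GaussianInt) : ℂ) / 7) / ((Real.Gamma (1 / 4) ^ 2 / (2 * Real.sqrt (2 * Real.pi)) : ℝ) : ℂ) ^ 2) -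
        (℘[ofUpperHalfPlane UpperHalfPlane.I] (((d : GaussianInt) : ℂ) / 7) / ((Real.Gamma (1 / 4) ^ 2 / (2 * Real.sqrt (2 * Real.pi)) : ℝ) : ℂ) ^ 2)) *
        (℘[ofUpperHalfPlane UpperHalfPlane.I] (((c : GaussianInt) : ℂ) / 7) / ((Real.Gamma (1 / 4) ^ 2 / (2 * Real.sqrt (2 * Real.pi)) : ℝ) : ℂ) ^ 2)) := by
  have hne : (℘[ofUpperHalfPlane UpperHalfPlane.I] (((c : GaussianInt) : ℂ) / 7) / ((Real.Gamma (1 / 4) ^ 2 / (2 * Real.sqrt (2 * Real.pi)) : ℝ) : ℂ) ^ 2) ≠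
      (℘[ofUpperHalfPlane UpperHalfPlane.I] (((d : GaussianInt) : ℂ) / 7) / ((Real.Gamma (1 / 4) ^ 2 / (2 * Real.sqrt (2 * Real.pi)) : ℝ) : ℂ) ^ 2) := X_ne_X hc hd hs hm
  have hsub : (℘[ofUpperHalfPlane UpperHalfPlane.I] (((c : GaussianInt) : ℂ) / 7) / ((Real.Gamma (1 / 4) ^ 2 / (2 * Real.sqrt (2 * Real.pi)) : ℝ) : ℂ) ^ 2) -
      (℘[ofUpperHalfPlane UpperHalfPlane.I] (((d : GaussianInt) : ℂ) / 7) / ((Real.Gamma (1 / 4) ^ 2 / (2 * Real.sqrt (2 * Real.pi)) : ℝ) : ℂ) ^ 2) ≠ 0 := sub_ne_zero.mpr hne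
  have hne' : ℘[ofUpperHalfPlane UpperHalfPlane.I] (((c : GaussianInt) : ℂ) / 7) ≠ ℘[ofUpperHalfPlane UpperHalfPlane.I] (((d : GaussianInt) : ℂ) / 7) := fun h ↦ hne (by rw [h])
  have hcu := div_seven_notMem hc
  have hdu := div_seven_notMem hd
  have hcd : (((c + d : GaussianInt)) : ℂ) / 7 = ((c : GaussianInt) : ℂ) / 7 + ((d : GaussianInt) : ℂ) / 7 := by
    rw [map_add, add_div]
  refine ⟨by ring, ?_, ?_⟩
  · field_simp
    ring
  · have hY := normalizedY_add hcu hdu hne'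
    rw [hcd, hY]
    ring

end Chord

/-! ## §4 First-order additivity of `t = X/Y` on the `7`-division points -/

section FirstOrder

variable {Γ₀ : Type*} [LinearOrderedCommGroupWithZero Γ₀] (v : Valuation ℂ Γ₀)

/-- ★ **`v(t_{c+d} − t_c − t_d) ≤ v(t_1)⁵`** for a GENERIC pair: `c, d, c + d, c − d, 2c + d, c + 2d ∉ 7ℤ[i]` (brick 1 applied to the
chord `P_c, P_d, −P_{c+d}`; the side conditions make `t_c, t_d, −t_{c+d}` pairwise distinct). [cite: SilvermanAEC2009, IV.1] -/
theorem val_t_add_sub_le (h7 : v 7 < 1) {c d : GaussianInt} (hc : ¬ (7 : GaussianInt) ∣ c) (hd : ¬ (7 : GaussianInt) ∣ d)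
    (hs : ¬ (7 : GaussianInt) ∣ c + d) (hm : ¬ (7 : GaussianInt) ∣ c - d) (h2 : ¬ (7 : GaussianInt) ∣ 2 * c + d)
    (h2' : ¬ (7 : GaussianInt) ∣ c + 2 * d) :
    v ((℘[ofUpperHalfPlane UpperHalfPlane.I] ((((c + d) : GaussianInt) : ℂ) / 7) / ((Real.Gamma (1 / 4) ^ 2 / (2 * Real.sqrt (2 * Real.pi)) : ℝ) : ℂ) ^ 2) /
        (℘'[ofUpperHalfPlane UpperHalfPlane.I] ((((c + d) : GaussianInt) : ℂ) / 7) / (2 * ((Real.Gamma (1 / 4) ^ 2 / (2 * Real.sqrt (2 * Real.pi)) : ℝ) : ℂ) ^ 3)) -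
        (℘[ofUpperHalfPlane UpperHalfPlane.I] (((c : GaussianInt) : ℂ) / 7) / ((Real.Gamma (1 / 4) ^ 2 / (2 * Real.sqrt (2 * Real.pi)) : ℝ) : ℂ) ^ 2) /
        (℘'[ofUpperHalfPlane UpperHalfPlane.I] (((c : GaussianInt) : ℂ) / 7) / (2 * ((Real.Gamma (1 / 4) ^ 2 / (2 * Real.sqrt (2 * Real.pi)) : ℝ) : ℂ) ^ 3)) -
        (℘[ofUpperHalfPlane UpperHalfPlane.I] (((d : GaussianInt) : ℂ) / 7) / ((Real.Gamma (1 / 4) ^ 2 / (2 * Real.sqrt (2 * Real.pi)) : ℝ) : ℂ) ^ 2) /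
        (℘'[ofUpperHalfPlane UpperHalfPlane.I] (((d : GaussianInt) : ℂ) / 7) / (2 * ((Real.Gamma (1 / 4) ^ 2 / (2 * Real.sqrt (2 * Real.pi)) : ℝ) : ℂ) ^ 3))) ≤ v
        ((℘[ofUpperHalfPlane UpperHalfPlane.I] (((1 : GaussianInt) : ℂ) / 7) / ((Real.Gamma (1 / 4) ^ 2 / (2 * Real.sqrt (2 * Real.pi)) : ℝ) : ℂ) ^ 2) /
        (℘'[ofUpperHalfPlane UpperHalfPlane.I] (((1 : GaussianInt) : ℂ) / 7) / (2 * ((Real.Gamma (1 / 4) ^ 2 / (2 * Real.sqrt (2 * Real.pi)) : ℝ) : ℂ) ^ 3))) ^ 5 := by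
  obtain ⟨hl₁, hl₂, hl₃⟩ := chord_collinear hc hd hs hm
  obtain ⟨-, hYc, -, -⟩ := val_division v h7 hc
  obtain ⟨-, hYd, -, -⟩ := val_division v h7 hd
  obtain ⟨-, hYs, -, -⟩ := val_division v h7 hs
  have h1 : ¬ (7 : GaussianInt) ∣ 1 := fun h ↦ by
    have := (seven_dvd_iff 1).mp h; norm_num at this
  have hρ := (val_t_lt_one v h7 h1).2
  -- distinctness of the parameters
  have h12 : (℘[ofUpperHalfPlane UpperHalfPlane.I] (((c : GaussianInt) : ℂ) / 7) / ((Real.Gamma (1 / 4) ^ 2 / (2 * Real.sqrt (2 * Real.pi)) : ℝ) : ℂ) ^ 2) /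
      (℘'[ofUpperHalfPlane UpperHalfPlane.I] (((c : GaussianInt) : ℂ) / 7) / (2 * ((Real.Gamma (1 / 4) ^ 2 / (2 * Real.sqrt (2 * Real.pi)) : ℝ) : ℂ) ^ 3)) ≠
      (℘[ofUpperHalfPlane UpperHalfPlane.I] (((d : GaussianInt) : ℂ) / 7) / ((Real.Gamma (1 / 4) ^ 2 / (2 * Real.sqrt (2 * Real.pi)) : ℝ) : ℂ) ^ 2) /
      (℘'[ofUpperHalfPlane UpperHalfPlane.I] (((d : GaussianInt) : ℂ) / 7) / (2 * ((Real.Gamma (1 / 4) ^ 2 / (2 * Real.sqrt (2 * Real.pi)) : ℝ) : ℂ) ^ 3)) := fun h ↦ hm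
      (dvd_sub_of_t_eq v h7 hc hd h)
  have hneg := X_Y_neg (c + d)
  have hns : ¬ (7 : GaussianInt) ∣ -(c + d) := fun h ↦ hs (by rwa [dvd_neg] at h)
  have htneg : -((℘[ofUpperHalfPlane UpperHalfPlane.I] ((((c + d) : GaussianInt) : ℂ) / 7) / ((Real.Gamma (1 / 4) ^ 2 / (2 * Real.sqrt (2 * Real.pi)) : ℝ) : ℂ) ^ 2) /
      (℘'[ofUpperHalfPlane UpperHalfPlane.I] ((((c + d) : GaussianInt) : ℂ) / 7) / (2 * ((Real.Gamma (1 / 4) ^ 2 / (2 * Real.sqrt (2 * Real.pi)) : ℝ) : ℂ) ^ 3))) =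
      (℘[ofUpperHalfPlane UpperHalfPlane.I] ((((-(c + d)) : GaussianInt) : ℂ) / 7) / ((Real.Gamma (1 / 4) ^ 2 / (2 * Real.sqrt (2 * Real.pi)) : ℝ) : ℂ) ^ 2) /
      (℘'[ofUpperHalfPlane UpperHalfPlane.I] ((((-(c + d)) : GaussianInt) : ℂ) / 7) / (2 * ((Real.Gamma (1 / 4) ^ 2 / (2 * Real.sqrt (2 * Real.pi)) : ℝ) : ℂ) ^ 3)) := by
    rw [hneg.1, hneg.2]; ring
  have h13 : (℘[ofUpperHalfPlane UpperHalfPlane.I] (((c : GaussianInt) : ℂ) / 7) / ((Real.Gamma (1 / 4) ^ 2 / (2 * Real.sqrt (2 * Real.pi)) : ℝ) : ℂ) ^ 2) /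
      (℘'[ofUpperHalfPlane UpperHalfPlane.I] (((c : GaussianInt) : ℂ) / 7) / (2 * ((Real.Gamma (1 / 4) ^ 2 / (2 * Real.sqrt (2 * Real.pi)) : ℝ) : ℂ) ^ 3)) ≠
      -((℘[ofUpperHalfPlane UpperHalfPlane.I] ((((c + d) : GaussianInt) : ℂ) / 7) / ((Real.Gamma (1 / 4) ^ 2 / (2 * Real.sqrt (2 * Real.pi)) : ℝ) : ℂ) ^ 2) /
      (℘'[ofUpperHalfPlane UpperHalfPlane.I] ((((c + d) : GaussianInt) : ℂ) / 7) / (2 * ((Real.Gamma (1 / 4) ^ 2 / (2 * Real.sqrt (2 * Real.pi)) : ℝ) : ℂ) ^ 3))) := fun h ↦ by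
    rw [htneg] at h
    have hdvd := dvd_sub_of_t_eq v h7 hc hns h
    have e : c - -(c + d) = 2 * c + d := by ring
    rw [e] at hdvd
    exact h2 hdvd
  have h23 : (℘[ofUpperHalfPlane UpperHalfPlane.I] (((d : GaussianInt) : ℂ) / 7) / ((Real.Gamma (1 / 4) ^ 2 / (2 * Real.sqrt (2 * Real.pi)) : ℝ) : ℂ) ^ 2) /
      (℘'[ofUpperHalfPlane UpperHalfPlane.I] (((d : GaussianInt) : ℂ) / 7) / (2 * ((Real.Gamma (1 / 4) ^ 2 / (2 * Real.sqrt (2 * Real.pi)) : ℝ) : ℂ) ^ 3)) ≠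
      -((℘[ofUpperHalfPlane UpperHalfPlane.I] ((((c + d) : GaussianInt) : ℂ) / 7) / ((Real.Gamma (1 / 4) ^ 2 / (2 * Real.sqrt (2 * Real.pi)) : ℝ) : ℂ) ^ 2) /
      (℘'[ofUpperHalfPlane UpperHalfPlane.I] ((((c + d) : GaussianInt) : ℂ) / 7) / (2 * ((Real.Gamma (1 / 4) ^ 2 / (2 * Real.sqrt (2 * Real.pi)) : ℝ) : ℂ) ^ 3))) := fun h ↦ by
    rw [htneg] at h
    have hdvd := dvd_sub_of_t_eq v h7 hd hns h
    have e : d - -(c + d) = c + 2 * d := by ring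
    rw [e] at hdvd
    exact h2' hdvd
  -- valuations of the inputs
  have hvc : v ((℘[ofUpperHalfPlane UpperHalfPlane.I] (((c : GaussianInt) : ℂ) / 7) / ((Real.Gamma (1 / 4) ^ 2 / (2 * Real.sqrt (2 * Real.pi)) : ℝ) : ℂ) ^ 2) /
      (℘'[ofUpperHalfPlane UpperHalfPlane.I] (((c : GaussianInt) : ℂ) / 7) / (2 * ((Real.Gamma (1 / 4) ^ 2 / (2 * Real.sqrt (2 * Real.pi)) : ℝ) : ℂ) ^ 3))) ≤ v
      ((℘[ofUpperHalfPlane UpperHalfPlane.I] (((1 : GaussianInt) : ℂ) / 7) / ((Real.Gamma (1 / 4) ^ 2 / (2 * Real.sqrt (2 * Real.pi)) : ℝ) : ℂ) ^ 2) /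
      (℘'[ofUpperHalfPlane UpperHalfPlane.I] (((1 : GaussianInt) : ℂ) / 7) / (2 * ((Real.Gamma (1 / 4) ^ 2 / (2 * Real.sqrt (2 * Real.pi)) : ℝ) : ℂ) ^ 3))) := (val_t_eq v h7 hc h1).le
  have hvd : v ((℘[ofUpperHalfPlane UpperHalfPlane.I] (((d : GaussianInt) : ℂ) / 7) / ((Real.Gamma (1 / 4) ^ 2 / (2 * Real.sqrt (2 * Real.pi)) : ℝ) : ℂ) ^ 2) /
      (℘'[ofUpperHalfPlane UpperHalfPlane.I] (((d : GaussianInt) : ℂ) / 7) / (2 * ((Real.Gamma (1 / 4) ^ 2 / (2 * Real.sqrt (2 * Real.pi)) : ℝ) : ℂ) ^ 3))) ≤ v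
      ((℘[ofUpperHalfPlane UpperHalfPlane.I] (((1 : GaussianInt) : ℂ) / 7) / ((Real.Gamma (1 / 4) ^ 2 / (2 * Real.sqrt (2 * Real.pi)) : ℝ) : ℂ) ^ 2) /
      (℘'[ofUpperHalfPlane UpperHalfPlane.I] (((1 : GaussianInt) : ℂ) / 7) / (2 * ((Real.Gamma (1 / 4) ^ 2 / (2 * Real.sqrt (2 * Real.pi)) : ℝ) : ℂ) ^ 3))) := (val_t_eq v h7 hd h1).le
  have hwc : v ((℘'[ofUpperHalfPlane UpperHalfPlane.I] (((c : GaussianInt) : ℂ) / 7) / (2 * ((Real.Gamma (1 / 4) ^ 2 / (2 * Real.sqrt (2 * Real.pi)) : ℝ) : ℂ) ^ 3)))⁻¹ ≤ v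
      ((℘[ofUpperHalfPlane UpperHalfPlane.I] (((1 : GaussianInt) : ℂ) / 7) / ((Real.Gamma (1 / 4) ^ 2 / (2 * Real.sqrt (2 * Real.pi)) : ℝ) : ℂ) ^ 2) /
      (℘'[ofUpperHalfPlane UpperHalfPlane.I] (((1 : GaussianInt) : ℂ) / 7) / (2 * ((Real.Gamma (1 / 4) ^ 2 / (2 * Real.sqrt (2 * Real.pi)) : ℝ) : ℂ) ^ 3))) ^ 3 := by
    have e1 := (val_inv_X_Y v h7 hc).2
    rw [val_t_eq v h7 hc h1] at e1
    exact e1.le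
  have hwd : v ((℘'[ofUpperHalfPlane UpperHalfPlane.I] (((d : GaussianInt) : ℂ) / 7) / (2 * ((Real.Gamma (1 / 4) ^ 2 / (2 * Real.sqrt (2 * Real.pi)) : ℝ) : ℂ) ^ 3)))⁻¹ ≤ v
      ((℘[ofUpperHalfPlane UpperHalfPlane.I] (((1 : GaussianInt) : ℂ) / 7) / ((Real.Gamma (1 / 4) ^ 2 / (2 * Real.sqrt (2 * Real.pi)) : ℝ) : ℂ) ^ 2) /
      (℘'[ofUpperHalfPlane UpperHalfPlane.I] (((1 : GaussianInt) : ℂ) / 7) / (2 * ((Real.Gamma (1 / 4) ^ 2 / (2 * Real.sqrt (2 * Real.pi)) : ℝ) : ℂ) ^ 3))) ^ 3 := by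
    have e1 := (val_inv_X_Y v h7 hd).2
    rw [val_t_eq v h7 hd h1] at e1
    exact e1.le
  exact val_formalParameter_add_le v (curve_X_Y hc) (curve_X_Y hd) (curve_X_Y hs) hYc hYd hYs hl₁ hl₂ hl₃ h12 h13 h23 hρ
    hvc hvd hwc hwd

end FirstOrder

/-! ## §5 The tame character is the CM character: `t_u ≡ u·t_1 (mod 𝔪 t)` -/

section TameCharacter

variable {Γ₀ : Type*} [LinearOrderedCommGroupWithZero Γ₀] (v : Valuation ℂ Γ₀)

/-- ★★ **`v(t_u − u·t_1) < v(t_1)` for every `u ∈ ℤ[i] ∖ 7ℤ[i]`** and every valuation `v` of `ℂ` with `v 7 < 1`: on the `7`-division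
points of `y² = x³ − x` the parameter `t = x/y` is `ℤ[i]`-LINEAR TO FIRST ORDER, `t(uQ₁) ≡ u·t(Q₁) (mod 𝔪·t(Q₁))`. Hence the tame
character `θ(σ_u) = t(σ_u Q₁)/t(Q₁)` of the totally ramified layer `ℚ(i)(E₀[7])/ℚ(i)` at `7` is `≡ u (mod 𝔪)` — the exponent
`a ≡ 1 (mod 4)` of memo PLAIN-ODD-57 §3(d), pinned by `[i](x,y) = (−x, iy)` and the formal group law. (Induction §1 over generic sums
§4, `[i]` and `[−1]` exactly §2, and `7t_1 ∈ 𝔪·t_1` for the reduction modulo `7`.) [cite: Serre1979, Ch. IV §2 Prop. 7]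
[cite: SilvermanATAEC1994, II.2] -/
theorem val_t_sub_mul_lt (h7 : v 7 < 1) (u : GaussianInt) (hu : ¬ (7 : GaussianInt) ∣ u) :
    v ((℘[ofUpperHalfPlane UpperHalfPlane.I] (((u : GaussianInt) : ℂ) / 7) / ((Real.Gamma (1 / 4) ^ 2 / (2 * Real.sqrt (2 * Real.pi)) : ℝ) : ℂ) ^ 2) /
        (℘'[ofUpperHalfPlane UpperHalfPlane.I] (((u : GaussianInt) : ℂ) / 7) / (2 * ((Real.Gamma (1 / 4) ^ 2 / (2 * Real.sqrt (2 * Real.pi)) : ℝ) : ℂ) ^ 3)) - ((u : GaussianInt) : ℂ) *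
        ((℘[ofUpperHalfPlane UpperHalfPlane.I] (((1 : GaussianInt) : ℂ) / 7) / ((Real.Gamma (1 / 4) ^ 2 / (2 * Real.sqrt (2 * Real.pi)) : ℝ) : ℂ) ^ 2) /
        (℘'[ofUpperHalfPlane UpperHalfPlane.I] (((1 : GaussianInt) : ℂ) / 7) / (2 * ((Real.Gamma (1 / 4) ^ 2 / (2 * Real.sqrt (2 * Real.pi)) : ℝ) : ℂ) ^ 3)))) < v
        ((℘[ofUpperHalfPlane UpperHalfPlane.I] (((1 : GaussianInt) : ℂ) / 7) / ((Real.Gamma (1 / 4) ^ 2 / (2 * Real.sqrt (2 * Real.pi)) : ℝ) : ℂ) ^ 2) /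
        (℘'[ofUpperHalfPlane UpperHalfPlane.I] (((1 : GaussianInt) : ℂ) / 7) / (2 * ((Real.Gamma (1 / 4) ^ 2 / (2 * Real.sqrt (2 * Real.pi)) : ℝ) : ℂ) ^ 3))) := by
  have h1 : ¬ (7 : GaussianInt) ∣ 1 := fun h ↦ by
    have := (seven_dvd_iff 1).mp h; norm_num at this
  obtain ⟨hρ0, hρ1⟩ := val_t_lt_one v h7 h1
  set r := v ((℘[ofUpperHalfPlane UpperHalfPlane.I] (((1 : GaussianInt) : ℂ) / 7) / ((Real.Gamma (1 / 4) ^ 2 / (2 * Real.sqrt (2 * Real.pi)) : ℝ) : ℂ) ^ 2) /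
      (℘'[ofUpperHalfPlane UpperHalfPlane.I] (((1 : GaussianInt) : ℂ) / 7) / (2 * ((Real.Gamma (1 / 4) ^ 2 / (2 * Real.sqrt (2 * Real.pi)) : ℝ) : ℂ) ^ 3))) with hr
  -- `v i = 1` and Gaussian integers have valuation `≤ 1`
  have hvI : v I = 1 := by
    apply pow_left_injective (by norm_num : (4 : ℕ) ≠ 0)
    dsimp only
    rw [← Valuation.map_pow, Complex.I_pow_four, Valuation.map_one, one_pow]
  have hvint : ∀ e : GaussianInt, v ((e : GaussianInt) : ℂ) ≤ 1 := by
    intro e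
    rw [GaussianInt.toComplex_def]
    refine Valuation.map_add_le v ?_ ?_
    · exact val_intCast_le_one v e.re
    · rw [Valuation.map_mul, hvI, mul_one]
      exact val_intCast_le_one v e.im
  refine induction_mod_seven
      (P := fun u ↦ v ((℘[ofUpperHalfPlane UpperHalfPlane.I] (((u : GaussianInt) : ℂ) / 7) / ((Real.Gamma (1 / 4) ^ 2 / (2 * Real.sqrt (2 * Real.pi)) : ℝ) : ℂ) ^ 2) /
      (℘'[ofUpperHalfPlane UpperHalfPlane.I] (((u : GaussianInt) : ℂ) / 7) / (2 * ((Real.Gamma (1 / 4) ^ 2 / (2 * Real.sqrt (2 * Real.pi)) : ℝ) : ℂ) ^ 3)) - ((u : GaussianInt) : ℂ) *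
      ((℘[ofUpperHalfPlane UpperHalfPlane.I] (((1 : GaussianInt) : ℂ) / 7) / ((Real.Gamma (1 / 4) ^ 2 / (2 * Real.sqrt (2 * Real.pi)) : ℝ) : ℂ) ^ 2) /
      (℘'[ofUpperHalfPlane UpperHalfPlane.I] (((1 : GaussianInt) : ℂ) / 7) / (2 * ((Real.Gamma (1 / 4) ^ 2 / (2 * Real.sqrt (2 * Real.pi)) : ℝ) : ℂ) ^ 3)))) < r) ?_ ?_ ?_ ?_ ?_ u hu
  · -- `u = 1`
    simp only [GaussianInt.toComplex_one, one_mul, sub_self, Valuation.map_zero]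
    exact hρ0
  · -- `u ↦ iu`
    intro u hu hP
    obtain ⟨hX, hY⟩ := X_Y_I_mul u
    rw [hX, hY, toComplex_I_mul]
    have : -((℘[ofUpperHalfPlane UpperHalfPlane.I] (((u : GaussianInt) : ℂ) / 7) / ((Real.Gamma (1 / 4) ^ 2 / (2 * Real.sqrt (2 * Real.pi)) : ℝ) : ℂ) ^ 2)) /
        (I * (℘'[ofUpperHalfPlane UpperHalfPlane.I] (((u : GaussianInt) : ℂ) / 7) / (2 * ((Real.Gamma (1 / 4) ^ 2 / (2 * Real.sqrt (2 * Real.pi)) : ℝ) : ℂ) ^ 3))) - I * ((u : GaussianInt) : ℂ) *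
        ((℘[ofUpperHalfPlane UpperHalfPlane.I] (((1 : GaussianInt) : ℂ) / 7) / ((Real.Gamma (1 / 4) ^ 2 / (2 * Real.sqrt (2 * Real.pi)) : ℝ) : ℂ) ^ 2) /
        (℘'[ofUpperHalfPlane UpperHalfPlane.I] (((1 : GaussianInt) : ℂ) / 7) / (2 * ((Real.Gamma (1 / 4) ^ 2 / (2 * Real.sqrt (2 * Real.pi)) : ℝ) : ℂ) ^ 3))) =
        I * ((℘[ofUpperHalfPlane UpperHalfPlane.I] (((u : GaussianInt) : ℂ) / 7) / ((Real.Gamma (1 / 4) ^ 2 / (2 * Real.sqrt (2 * Real.pi)) : ℝ) : ℂ) ^ 2) /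
            (℘'[ofUpperHalfPlane UpperHalfPlane.I] (((u : GaussianInt) : ℂ) / 7) / (2 * ((Real.Gamma (1 / 4) ^ 2 / (2 * Real.sqrt (2 * Real.pi)) : ℝ) : ℂ) ^ 3)) - ((u : GaussianInt) : ℂ) *
            ((℘[ofUpperHalfPlane UpperHalfPlane.I] (((1 : GaussianInt) : ℂ) / 7) / ((Real.Gamma (1 / 4) ^ 2 / (2 * Real.sqrt (2 * Real.pi)) : ℝ) : ℂ) ^ 2) /
            (℘'[ofUpperHalfPlane UpperHalfPlane.I] (((1 : GaussianInt) : ℂ) / 7) / (2 * ((Real.Gamma (1 / 4) ^ 2 / (2 * Real.sqrt (2 * Real.pi)) : ℝ) : ℂ) ^ 3)))) := by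
      have hI : (I : ℂ) ≠ 0 := I_ne_zero
      field_simp
      ring_nf
      rw [Complex.I_sq]; ring
    rw [this, Valuation.map_mul, hvI, one_mul]
    exact hP
  · -- `u ↦ −u`
    intro u hu hP
    obtain ⟨hX, hY⟩ := X_Y_neg u
    rw [hX, hY, GaussianInt.toComplex_neg]
    have : (℘[ofUpperHalfPlane UpperHalfPlane.I] (((u : GaussianInt) : ℂ) / 7) / ((Real.Gamma (1 / 4) ^ 2 / (2 * Real.sqrt (2 * Real.pi)) : ℝ) : ℂ) ^ 2) /
        -((℘'[ofUpperHalfPlane UpperHalfPlane.I] (((u : GaussianInt) : ℂ) / 7) / (2 * ((Real.Gamma (1 / 4) ^ 2 / (2 * Real.sqrt (2 * Real.pi)) : ℝ) : ℂ) ^ 3))) - -((u : GaussianInt) : ℂ) *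
        ((℘[ofUpperHalfPlane UpperHalfPlane.I] (((1 : GaussianInt) : ℂ) / 7) / ((Real.Gamma (1 / 4) ^ 2 / (2 * Real.sqrt (2 * Real.pi)) : ℝ) : ℂ) ^ 2) /
        (℘'[ofUpperHalfPlane UpperHalfPlane.I] (((1 : GaussianInt) : ℂ) / 7) / (2 * ((Real.Gamma (1 / 4) ^ 2 / (2 * Real.sqrt (2 * Real.pi)) : ℝ) : ℂ) ^ 3))) =
        -((℘[ofUpperHalfPlane UpperHalfPlane.I] (((u : GaussianInt) : ℂ) / 7) / ((Real.Gamma (1 / 4) ^ 2 / (2 * Real.sqrt (2 * Real.pi)) : ℝ) : ℂ) ^ 2) /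
            (℘'[ofUpperHalfPlane UpperHalfPlane.I] (((u : GaussianInt) : ℂ) / 7) / (2 * ((Real.Gamma (1 / 4) ^ 2 / (2 * Real.sqrt (2 * Real.pi)) : ℝ) : ℂ) ^ 3)) - ((u : GaussianInt) : ℂ) *
            ((℘[ofUpperHalfPlane UpperHalfPlane.I] (((1 : GaussianInt) : ℂ) / 7) / ((Real.Gamma (1 / 4) ^ 2 / (2 * Real.sqrt (2 * Real.pi)) : ℝ) : ℂ) ^ 2) /
            (℘'[ofUpperHalfPlane UpperHalfPlane.I] (((1 : GaussianInt) : ℂ) / 7) / (2 * ((Real.Gamma (1 / 4) ^ 2 / (2 * Real.sqrt (2 * Real.pi)) : ℝ) : ℂ) ^ 3)))) := by ring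
    rw [this, Valuation.map_neg]
    exact hP
  · -- `u ≡ u′ (mod 7)`
    intro u u' hu huu' hP
    obtain ⟨hX, hY⟩ := X_Y_eq_of_dvd_sub huu'
    rw [hX, hY]
    obtain ⟨e, he⟩ := huu'
    have hu' : ((u' : GaussianInt) : ℂ) = ((u : GaussianInt) : ℂ) + 7 * ((e : GaussianInt) : ℂ) := by
      have : (u' : GaussianInt) = u + 7 * e := by rw [← he]; ring
      rw [this, map_add, map_mul, map_ofNat]
    rw [hu']
    have : (℘[ofUpperHalfPlane UpperHalfPlane.I] (((u : GaussianInt) : ℂ) / 7) / ((Real.Gamma (1 / 4) ^ 2 / (2 * Real.sqrt (2 * Real.pi)) : ℝ) : ℂ) ^ 2) /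
        (℘'[ofUpperHalfPlane UpperHalfPlane.I] (((u : GaussianInt) : ℂ) / 7) / (2 * ((Real.Gamma (1 / 4) ^ 2 / (2 * Real.sqrt (2 * Real.pi)) : ℝ) : ℂ) ^ 3)) -
        (((u : GaussianInt) : ℂ) + 7 * ((e : GaussianInt) : ℂ)) *
        ((℘[ofUpperHalfPlane UpperHalfPlane.I] (((1 : GaussianInt) : ℂ) / 7) / ((Real.Gamma (1 / 4) ^ 2 / (2 * Real.sqrt (2 * Real.pi)) : ℝ) : ℂ) ^ 2) /
        (℘'[ofUpperHalfPlane UpperHalfPlane.I] (((1 : GaussianInt) : ℂ) / 7) / (2 * ((Real.Gamma (1 / 4) ^ 2 / (2 * Real.sqrt (2 * Real.pi)) : ℝ) : ℂ) ^ 3))) =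
        ((℘[ofUpperHalfPlane UpperHalfPlane.I] (((u : GaussianInt) : ℂ) / 7) / ((Real.Gamma (1 / 4) ^ 2 / (2 * Real.sqrt (2 * Real.pi)) : ℝ) : ℂ) ^ 2) /
            (℘'[ofUpperHalfPlane UpperHalfPlane.I] (((u : GaussianInt) : ℂ) / 7) / (2 * ((Real.Gamma (1 / 4) ^ 2 / (2 * Real.sqrt (2 * Real.pi)) : ℝ) : ℂ) ^ 3)) - ((u : GaussianInt) : ℂ) *
            ((℘[ofUpperHalfPlane UpperHalfPlane.I] (((1 : GaussianInt) : ℂ) / 7) / ((Real.Gamma (1 / 4) ^ 2 / (2 * Real.sqrt (2 * Real.pi)) : ℝ) : ℂ) ^ 2) /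
            (℘'[ofUpperHalfPlane UpperHalfPlane.I] (((1 : GaussianInt) : ℂ) / 7) / (2 * ((Real.Gamma (1 / 4) ^ 2 / (2 * Real.sqrt (2 * Real.pi)) : ℝ) : ℂ) ^ 3)))) +
            -(7 * ((e : GaussianInt) : ℂ) *
            ((℘[ofUpperHalfPlane UpperHalfPlane.I] (((1 : GaussianInt) : ℂ) / 7) / ((Real.Gamma (1 / 4) ^ 2 / (2 * Real.sqrt (2 * Real.pi)) : ℝ) : ℂ) ^ 2) /
            (℘'[ofUpperHalfPlane UpperHalfPlane.I] (((1 : GaussianInt) : ℂ) / 7) / (2 * ((Real.Gamma (1 / 4) ^ 2 / (2 * Real.sqrt (2 * Real.pi)) : ℝ) : ℂ) ^ 3)))) := by ring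
    rw [this]
    refine Valuation.map_add_lt v hP ?_
    rw [Valuation.map_neg, Valuation.map_mul, Valuation.map_mul]
    calc v 7 * v ((e : GaussianInt) : ℂ) * r ≤ v 7 * 1 * r :=
          mul_le_mul' (mul_le_mul' le_rfl (hvint e)) le_rfl
      _ < r := by
          rw [mul_one]
          exact mul_lt_of_lt_one_left hρ0 h7
  · -- generic sums
    intro u u' hu hu' hs hm h2 h2' hP hP'
    have hadd := val_t_add_sub_le v h7 hu hu' hs hm h2 h2'
    have : (℘[ofUpperHalfPlane UpperHalfPlane.I] ((((u + u') : GaussianInt) : ℂ) / 7) / ((Real.Gamma (1 / 4) ^ 2 / (2 * Real.sqrt (2 * Real.pi)) : ℝ) : ℂ) ^ 2) /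
        (℘'[ofUpperHalfPlane UpperHalfPlane.I] ((((u + u') : GaussianInt) : ℂ) / 7) / (2 * ((Real.Gamma (1 / 4) ^ 2 / (2 * Real.sqrt (2 * Real.pi)) : ℝ) : ℂ) ^ 3)) -
        (((u + u' : GaussianInt)) : ℂ) *
        ((℘[ofUpperHalfPlane UpperHalfPlane.I] (((1 : GaussianInt) : ℂ) / 7) / ((Real.Gamma (1 / 4) ^ 2 / (2 * Real.sqrt (2 * Real.pi)) : ℝ) : ℂ) ^ 2) /
        (℘'[ofUpperHalfPlane UpperHalfPlane.I] (((1 : GaussianInt) : ℂ) / 7) / (2 * ((Real.Gamma (1 / 4) ^ 2 / (2 * Real.sqrt (2 * Real.pi)) : ℝ) : ℂ) ^ 3))) =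
        ((℘[ofUpperHalfPlane UpperHalfPlane.I] ((((u + u') : GaussianInt) : ℂ) / 7) / ((Real.Gamma (1 / 4) ^ 2 / (2 * Real.sqrt (2 * Real.pi)) : ℝ) : ℂ) ^ 2) /
            (℘'[ofUpperHalfPlane UpperHalfPlane.I] ((((u + u') : GaussianInt) : ℂ) / 7) / (2 * ((Real.Gamma (1 / 4) ^ 2 / (2 * Real.sqrt (2 * Real.pi)) : ℝ) : ℂ) ^ 3)) -
            (℘[ofUpperHalfPlane UpperHalfPlane.I] (((u : GaussianInt) : ℂ) / 7) / ((Real.Gamma (1 / 4) ^ 2 / (2 * Real.sqrt (2 * Real.pi)) : ℝ) : ℂ) ^ 2) /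
            (℘'[ofUpperHalfPlane UpperHalfPlane.I] (((u : GaussianInt) : ℂ) / 7) / (2 * ((Real.Gamma (1 / 4) ^ 2 / (2 * Real.sqrt (2 * Real.pi)) : ℝ) : ℂ) ^ 3)) -
            (℘[ofUpperHalfPlane UpperHalfPlane.I] (((u' : GaussianInt) : ℂ) / 7) / ((Real.Gamma (1 / 4) ^ 2 / (2 * Real.sqrt (2 * Real.pi)) : ℝ) : ℂ) ^ 2) /
            (℘'[ofUpperHalfPlane UpperHalfPlane.I] (((u' : GaussianInt) : ℂ) / 7) / (2 * ((Real.Gamma (1 / 4) ^ 2 / (2 * Real.sqrt (2 * Real.pi)) : ℝ) : ℂ) ^ 3))) +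
          (((℘[ofUpperHalfPlane UpperHalfPlane.I] (((u : GaussianInt) : ℂ) / 7) / ((Real.Gamma (1 / 4) ^ 2 / (2 * Real.sqrt (2 * Real.pi)) : ℝ) : ℂ) ^ 2) /
              (℘'[ofUpperHalfPlane UpperHalfPlane.I] (((u : GaussianInt) : ℂ) / 7) / (2 * ((Real.Gamma (1 / 4) ^ 2 / (2 * Real.sqrt (2 * Real.pi)) : ℝ) : ℂ) ^ 3)) - ((u : GaussianInt) : ℂ) *
              ((℘[ofUpperHalfPlane UpperHalfPlane.I] (((1 : GaussianInt) : ℂ) / 7) / ((Real.Gamma (1 / 4) ^ 2 / (2 * Real.sqrt (2 * Real.pi)) : ℝ) : ℂ) ^ 2) /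
              (℘'[ofUpperHalfPlane UpperHalfPlane.I] (((1 : GaussianInt) : ℂ) / 7) / (2 * ((Real.Gamma (1 / 4) ^ 2 / (2 * Real.sqrt (2 * Real.pi)) : ℝ) : ℂ) ^ 3)))) +
            ((℘[ofUpperHalfPlane UpperHalfPlane.I] (((u' : GaussianInt) : ℂ) / 7) / ((Real.Gamma (1 / 4) ^ 2 / (2 * Real.sqrt (2 * Real.pi)) : ℝ) : ℂ) ^ 2) /
                (℘'[ofUpperHalfPlane UpperHalfPlane.I] (((u' : GaussianInt) : ℂ) / 7) / (2 * ((Real.Gamma (1 / 4) ^ 2 / (2 * Real.sqrt (2 * Real.pi)) : ℝ) : ℂ) ^ 3)) - ((u' : GaussianInt) : ℂ) *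
                ((℘[ofUpperHalfPlane UpperHalfPlane.I] (((1 : GaussianInt) : ℂ) / 7) / ((Real.Gamma (1 / 4) ^ 2 / (2 * Real.sqrt (2 * Real.pi)) : ℝ) : ℂ) ^ 2) /
                (℘'[ofUpperHalfPlane UpperHalfPlane.I] (((1 : GaussianInt) : ℂ) / 7) / (2 * ((Real.Gamma (1 / 4) ^ 2 / (2 * Real.sqrt (2 * Real.pi)) : ℝ) : ℂ) ^ 3))))) := by
      rw [map_add]; ring
    rw [this]
    refine Valuation.map_add_lt v (lt_of_le_of_lt hadd ?_) (Valuation.map_add_lt v hP hP')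
    calc r ^ 5 < r ^ 1 := pow_lt_pow_right_of_lt_one₀ hρ0 hρ1 (by norm_num)
      _ = r := pow_one r

end TameCharacter

end Summit.BirchSwinnertonDyer.BirchSwinnertonDyer.Theorems.BiquadraticEisensteinDescentManinDatumSupercuspidalCMInertSevenDivisionTameCharacter

end
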